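import Summits.AnomalousDissipation.AnomalousDissipation.Theorems.SolenoidalFractalHomogenisationLagrangianStepCellLawVGreenPairing
import Summits.AnomalousDissipation.AnomalousDissipation.Theorems.SolenoidalFractalHomogenisationLagrangianStepCellLawVGreenDuhamel
import Summits.AnomalousDissipation.AnomalousDissipation.Theorems.SolenoidalFractalHomogenisationLagrangianStepCellLawVOddGainDefectLowerEdge
import HarnessLib

/-!
# K1L `LagrangianRenormalisationStep(Design)` (K1L_D, stmt-AnomalousDissipation-27980; aside 24912), stub `stub_cellLawV0_IS`
# — EXACT SECTOR NON-EXPANSION OF THE SLOT RESPONSE `f_T(B)` (time-domain Green pairing; no Fourier analysis)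
# (helper; `--supports stmt-AnomalousDissipation-27980`; word-independent)

Summits-side helper file of route `SolenoidalFractalHomogenisation` (prover seat `ad-k1l-cellLawV-w1` g2), on top of `…CellLawVGreenPairing` (p658771)
and `…CellLawVGreenDuhamel` (p658780).  The first conjunct of the per-slot hypothesis `hL1` of `oddSectorial_excQS_strict_of_slot` (p650822) —
sector PRESERVATION by the slot response — is proved here EXACTLY, for every ramp, every `T ≥ 0` and every sectorial block, superseding the
first-order growth factor `τ' = τ·hi·g_T(lo)/m → τ·(hi/lo)²` of `…SectorialSlot` (p655074):
* §15 `abs_le_half_mul_of_sq_le` (`S² ≤ t²ab ⇒ |S| ≤ (t/2)(λa + b/λ)`), `sq_le_of_forall_lambda` (the `λ`-optimisation);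
* §16 **`green_sector_abstract`** — for forward/backward Duhamel solutions `a, b` (source `φx`) and `c, d` (source `φz`) of a matrix `C` whose form
  has non-negative diagonal in the sector `τ`, the pairings `F_{yv} = 2∫₀¹φ·(y·(u⁺_v + u⁻_v))` satisfy `(F_{xz} − F_{zx})² ≤ τ²F_{xx}F_{zz}`
  (`green_energy`: each `F` = `∫[(a+b)·Cᵀ(c+d) + (b−a)·C(d−c)]` + symmetric boundary terms; pointwise `sector_add_aux`; integrate the `λ`-family);
* §17 `integral_pairing_duhamelFwd` (`T∫a·(y·u⁺_v) = yᵀf_T(B)v`, `C = T·B`), `integral_pairing_duhamelBwd_eq` (backward pairing = forward pairing,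
  i.e. Fubini on the triangle via `green_swap` with the `Cᵀ`-adjoint), and
  **`sector_form_qsResp_exact`**: `(xᵀf_T(B)z − zᵀf_T(B)x)² ≤ τ²·(xᵀf_T(B)x)(zᵀf_T(B)z)` whenever `uᵀBu ≥ 0` and
  `(uᵀBw − wᵀBu)² ≤ τ²·uᵀBu·wᵀBw`.
Consequence for the design (sequel): the contraction factor of the quasi-static excess becomes `κ = c√5/3` with the WINDOW box ratio `c` only
(`≈ 0.745·ΛV²·(1 + O(τ₀²))` instead of `0.745·ΛV⁶`), so the tenure sheet's `ΛV = 1.05` is admissible.  Everything PROVED, no definition, no named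
fact, no sorry.  Infrastructure for route-1's rung leaf F-D1.A0 (frontier FORMAL rung); NOT a proof of the stub, of the crux, of Onsager's
conjecture or of anomalous dissipation.  Prover seat `ad-k1l-cellLawV-w1` g2, 2026-08-28.
-/

set_option linter.dupNamespace false

noncomputable section

namespace Summit.AnomalousDissipation.AnomalousDissipation.Theorems.SolenoidalFractalHomogenisation.LagrangianStep.OddGain

open Matrix Finset MeasureTheory Set
open Literature.Analysis Literature.Analysis.FunctionSpaces Literature.Analysis.FluidPDE
open Literature.Analysis.FluidPDE.LatticeShear

/-! ## §15 Two elementary real lemmas -/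

section RealLemmas

/-- From `S² ≤ t²ab` (`t, a, b ≥ 0`) to the one-parameter family `|S| ≤ (t/2)(λa + b/λ)`, `λ > 0` (AM–GM, no square roots). -/
theorem abs_le_half_mul_of_sq_le {S t a b lam : ℝ} (ht : 0 ≤ t) (ha : 0 ≤ a) (hb : 0 ≤ b) (hlam : 0 < lam)
    (h : S ^ 2 ≤ t ^ 2 * (a * b)) : |S| ≤ t / 2 * (lam * a + b / lam) := by
  have hnn : 0 ≤ t / 2 * (lam * a + b / lam) := by positivity
  refine abs_le_of_sq_le_sq' ?_ hnn |> fun h2 => abs_le.2 h2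
  have hamgm : 4 * (a * b) ≤ (lam * a + b / lam) ^ 2 := by
    have e : (lam * a + b / lam) ^ 2 = (lam * a - b / lam) ^ 2 + 4 * (a * b) := by
      field_simp
      ring
    rw [e]; nlinarith [sq_nonneg (lam * a - b / lam)]
  calc S ^ 2 ≤ t ^ 2 * (a * b) := h
    _ ≤ t ^ 2 * ((lam * a + b / lam) ^ 2 / 4) := mul_le_mul_of_nonneg_left (by linarith) (sq_nonneg t)
    _ = (t / 2 * (lam * a + b / lam)) ^ 2 := by ring

/-- The `λ`-optimisation: if `|D| ≤ (t/2)(λA + B/λ)` for every `λ > 0` (`t, A, B ≥ 0`), then `D² ≤ t²AB`. -/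
theorem sq_le_of_forall_lambda {D t A B : ℝ} (ht : 0 ≤ t) (hA : 0 ≤ A) (hB : 0 ≤ B)
    (h : ∀ lam : ℝ, 0 < lam → |D| ≤ t / 2 * (lam * A + B / lam)) : D ^ 2 ≤ t ^ 2 * (A * B) := by
  have hD0 : 0 ≤ |D| := abs_nonneg D
  rcases hA.eq_or_lt with hA0 | hApos
  · -- `A = 0`: `|D| ≤ (t/2)·B/λ` for all `λ`, hence `D = 0`
    rw [← hA0, zero_mul, mul_zero]
    by_contra hne
    have hDpos : 0 < |D| := by
      rcases hD0.eq_or_lt with h0 | h0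
      · exact absurd (by rw [sq_eq_zero_iff.2 (abs_eq_zero.1 h0.symm)]) hne
      · exact h0
    have htB : 0 < t * B := by
      by_contra hle
      have hle' : t * B ≤ 0 := not_lt.1 hle
      have := h 1 one_pos
      rw [← hA0] at this
      nlinarith
    have h1 := h (t * B / |D|) (div_pos htB hDpos)
    rw [← hA0] at h1
    have ht0 : t ≠ 0 := by rintro rfl; simp at htB
    have hB0 : B ≠ 0 := by rintro rfl; simp at htB
    have hD0' : |D| ≠ 0 := hDpos.ne'
    have e : t / 2 * (t * B / |D| * 0 + B / (t * B / |D|)) = |D| / 2 := by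
      field_simp
      ring
    rw [e] at h1
    linarith
  rcases hB.eq_or_lt with hB0 | hBpos
  · rw [← hB0, mul_zero, mul_zero]
    by_contra hne
    have hDpos : 0 < |D| := by
      rcases hD0.eq_or_lt with h0 | h0
      · exact absurd (by rw [sq_eq_zero_iff.2 (abs_eq_zero.1 h0.symm)]) hne
      · exact h0
    have htA : 0 < t * A := by
      by_contra hle
      have hle' : t * A ≤ 0 := not_lt.1 hle
      have := h 1 one_pos
      rw [← hB0] at this
      nlinarith
    have h1 := h (|D| / (t * A)) (div_pos hDpos htA)
    rw [← hB0] at h1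
    have ht0 : t ≠ 0 := by rintro rfl; simp at htA
    have hA0 : A ≠ 0 := hApos.ne'
    have hD0' : |D| ≠ 0 := hDpos.ne'
    have e : t / 2 * (|D| / (t * A) * A + 0 / (|D| / (t * A))) = |D| / 2 := by
      field_simp
      ring
    rw [e] at h1
    linarith
  -- `A, B > 0`: take `λ = √B/√A`
  have hsA := Real.sqrt_pos.2 hApos
  have hsB := Real.sqrt_pos.2 hBpos
  have h1 := h (Real.sqrt B / Real.sqrt A) (div_pos hsB hsA)
  have e : Real.sqrt B / Real.sqrt A * A + B / (Real.sqrt B / Real.sqrt A) = 2 * (Real.sqrt A * Real.sqrt B) := by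
    have eA := Real.mul_self_sqrt hA
    have eB := Real.mul_self_sqrt hB
    field_simp
    nlinarith [eA, eB]
  rw [e] at h1
  have h2 : |D| ≤ t * (Real.sqrt A * Real.sqrt B) := by linarith
  have h3 := pow_le_pow_left₀ hD0 h2 2
  rw [sq_abs] at h3
  calc D ^ 2 ≤ (t * (Real.sqrt A * Real.sqrt B)) ^ 2 := h3
    _ = t ^ 2 * (A * B) := by rw [mul_pow, mul_pow, Real.sq_sqrt hA, Real.sq_sqrt hB]

end RealLemmas

/-! ## §16 The abstract Green sector theorem -/

section GreenSector

/-- **THE GREEN SECTOR THEOREM (abstract).**  Let `C` have non-negative quadratic form in the Kato sector `τ ≥ 0`, `φ` continuous, and let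
`a, b` (resp. `c, d`) be forward/backward Duhamel solutions with source `φ·x` (resp. `φ·z`) as in `green_energy`.  If
`F_{yv} = 2∫₀¹φ·(y·(fwd_v + bwd_v))` for the four pairs, then `(F_{xz} − F_{zx})² ≤ τ²·F_{xx}·F_{zz}`: by `green_energy` each `F` is an integral
of the sector-`τ` forms `(a+b)·Cᵀ(c+d) + (b−a)·C(d−c)` plus SYMMETRIC boundary terms, the integrand's odd part is pointwise
`≤ (τ/2)(λ·m_z + m_x/λ)` (`sector_add_aux`, AM–GM) and the `λ`-optimisation closes. [folklore] -/
theorem green_sector_abstract (C : Matrix (Fin 3) (Fin 3) ℝ) {φ : ℝ → ℝ} (hφ : Continuous φ) {τ : ℝ} (hτ : 0 ≤ τ)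
    (hpsd : ∀ u : Fin 3 → ℝ, 0 ≤ u ⬝ᵥ C *ᵥ u)
    (hsec : ∀ u w : Fin 3 → ℝ, (u ⬝ᵥ C *ᵥ w - w ⬝ᵥ C *ᵥ u) ^ 2 ≤ τ ^ 2 * ((u ⬝ᵥ C *ᵥ u) * (w ⬝ᵥ C *ᵥ w)))
    (x z : Fin 3 → ℝ) {a b c d : ℝ → Fin 3 → ℝ}
    (ha : ∀ s, HasDerivAt a (-(C *ᵥ a s) + φ s • x) s) (ha0 : a 0 = 0)
    (hb : ∀ s, HasDerivAt b (C *ᵥ b s - φ s • x) s) (hb1 : b 1 = 0)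
    (hc : ∀ s, HasDerivAt c (-(C *ᵥ c s) + φ s • z) s) (hc0 : c 0 = 0)
    (hd : ∀ s, HasDerivAt d (C *ᵥ d s - φ s • z) s) (hd1 : d 1 = 0)
    {Fxz Fzx Fxx Fzz : ℝ}
    (hxz : 2 * ∫ s in (0:ℝ)..1, φ s * (x ⬝ᵥ (c s + d s)) = Fxz) (hzx : 2 * ∫ s in (0:ℝ)..1, φ s * (z ⬝ᵥ (a s + b s)) = Fzx)
    (hxx : 2 * ∫ s in (0:ℝ)..1, φ s * (x ⬝ᵥ (a s + b s)) = Fxx) (hzz : 2 * ∫ s in (0:ℝ)..1, φ s * (z ⬝ᵥ (c s + d s)) = Fzz) :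
    (Fxz - Fzx) ^ 2 ≤ τ ^ 2 * (Fxx * Fzz) := by
  have hac : Continuous a := continuous_iff_continuousAt.2 fun s => (ha s).continuousAt
  have hbc : Continuous b := continuous_iff_continuousAt.2 fun s => (hb s).continuousAt
  have hcc : Continuous c := continuous_iff_continuousAt.2 fun s => (hc s).continuousAt
  have hdc : Continuous d := continuous_iff_continuousAt.2 fun s => (hd s).continuousAt
  -- the four Green energy identities
  have Exz := green_energy C hφ x z ha ha0 hb hb1 hc hc0 hd hd1
  have Ezx := green_energy C hφ z x hc hc0 hd hd1 ha ha0 hb hb1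
  have Exx := green_energy C hφ x x ha ha0 hb hb1 ha ha0 hb hb1
  have Ezz := green_energy C hφ z z hc hc0 hd hd1 hc hc0 hd hd1
  rw [hxz] at Exz
  rw [hzx] at Ezx
  rw [hxx] at Exx
  rw [hzz] at Ezz
  -- the integrands
  set Ixz : ℝ → ℝ := fun s => (a s + b s) ⬝ᵥ (Cᵀ *ᵥ (c s + d s)) + (b s - a s) ⬝ᵥ (C *ᵥ (d s - c s)) with hIxz
  set Izx : ℝ → ℝ := fun s => (c s + d s) ⬝ᵥ (Cᵀ *ᵥ (a s + b s)) + (d s - c s) ⬝ᵥ (C *ᵥ (b s - a s)) with hIzx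
  set mx : ℝ → ℝ := fun s => (a s + b s) ⬝ᵥ (Cᵀ *ᵥ (a s + b s)) + (b s - a s) ⬝ᵥ (C *ᵥ (b s - a s)) with hmx
  set mz : ℝ → ℝ := fun s => (c s + d s) ⬝ᵥ (Cᵀ *ᵥ (c s + d s)) + (d s - c s) ⬝ᵥ (C *ᵥ (d s - c s)) with hmz
  have cIxz : Continuous Ixz := ((hac.add hbc).dotProduct (continuous_const.matrix_mulVec (hcc.add hdc))).add
    ((hbc.sub hac).dotProduct (continuous_const.matrix_mulVec (hdc.sub hcc)))
  have cIzx : Continuous Izx := ((hcc.add hdc).dotProduct (continuous_const.matrix_mulVec (hac.add hbc))).add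
    ((hdc.sub hcc).dotProduct (continuous_const.matrix_mulVec (hbc.sub hac)))
  have cmx : Continuous mx := ((hac.add hbc).dotProduct (continuous_const.matrix_mulVec (hac.add hbc))).add
    ((hbc.sub hac).dotProduct (continuous_const.matrix_mulVec (hbc.sub hac)))
  have cmz : Continuous mz := ((hcc.add hdc).dotProduct (continuous_const.matrix_mulVec (hcc.add hdc))).add
    ((hdc.sub hcc).dotProduct (continuous_const.matrix_mulVec (hdc.sub hcc)))
  -- transposed form = form with arguments swapped
  have htr : ∀ u w : Fin 3 → ℝ, u ⬝ᵥ (Cᵀ *ᵥ w) = w ⬝ᵥ (C *ᵥ u) := fun u w => (form_comm_transpose C u w).symm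
  -- non-negativity of the diagonal integrands
  have hmx0 : ∀ s, 0 ≤ mx s := fun s => by
    simp only [hmx]; rw [htr]; exact add_nonneg (hpsd _) (hpsd _)
  have hmz0 : ∀ s, 0 ≤ mz s := fun s => by
    simp only [hmz]; rw [htr]; exact add_nonneg (hpsd _) (hpsd _)
  -- pointwise sector bound of the odd part, in the `λ`-family form
  have hpt : ∀ lam : ℝ, 0 < lam → ∀ s, |Ixz s - Izx s| ≤ τ / 2 * (lam * mz s + mx s / lam) := by
    intro lam hlam s
    refine abs_le_half_mul_of_sq_le hτ (hmz0 s) (hmx0 s) hlam ?_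
    have e : Ixz s - Izx s = ((c s + d s) ⬝ᵥ (C *ᵥ (a s + b s)) - (a s + b s) ⬝ᵥ (C *ᵥ (c s + d s))) +
        ((b s - a s) ⬝ᵥ (C *ᵥ (d s - c s)) - (d s - c s) ⬝ᵥ (C *ᵥ (b s - a s))) := by
      simp only [hIxz, hIzx]; rw [htr, htr]; ring
    rw [e]
    have h₁ := hsec (c s + d s) (a s + b s)
    have h₂ : ((b s - a s) ⬝ᵥ (C *ᵥ (d s - c s)) - (d s - c s) ⬝ᵥ (C *ᵥ (b s - a s))) ^ 2 ≤
        τ ^ 2 * (((d s - c s) ⬝ᵥ (C *ᵥ (d s - c s))) * ((b s - a s) ⬝ᵥ (C *ᵥ (b s - a s)))) := by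
      have h := hsec (d s - c s) (b s - a s)
      rwa [show ((d s - c s) ⬝ᵥ (C *ᵥ (b s - a s)) - (b s - a s) ⬝ᵥ (C *ᵥ (d s - c s))) ^ 2 =
        ((b s - a s) ⬝ᵥ (C *ᵥ (d s - c s)) - (d s - c s) ⬝ᵥ (C *ᵥ (b s - a s))) ^ 2 by ring] at h
    have key := sector_add_aux (hpsd (c s + d s)) (hpsd (a s + b s)) (hpsd (d s - c s)) (hpsd (b s - a s)) h₁ h₂
    have emz : mz s = (c s + d s) ⬝ᵥ (C *ᵥ (c s + d s)) + (d s - c s) ⬝ᵥ (C *ᵥ (d s - c s)) := by simp only [hmz]; rw [htr]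
    have emx : mx s = (a s + b s) ⬝ᵥ (C *ᵥ (a s + b s)) + (b s - a s) ⬝ᵥ (C *ᵥ (b s - a s)) := by simp only [hmx]; rw [htr]
    rw [emz, emx]
    exact key
  -- integrate the pointwise bound
  have hIint : ∫ s in (0:ℝ)..1, (Ixz s - Izx s) = (∫ s in (0:ℝ)..1, Ixz s) - ∫ s in (0:ℝ)..1, Izx s :=
    intervalIntegral.integral_sub (cIxz.intervalIntegrable _ _) (cIzx.intervalIntegrable _ _)
  have hbound : ∀ lam : ℝ, 0 < lam →
      |(∫ s in (0:ℝ)..1, Ixz s) - ∫ s in (0:ℝ)..1, Izx s| ≤ τ / 2 * (lam * (∫ s in (0:ℝ)..1, mz s) + (∫ s in (0:ℝ)..1, mx s) / lam) := by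
    intro lam hlam
    rw [← hIint]
    have h1 : |∫ s in (0:ℝ)..1, (Ixz s - Izx s)| ≤ ∫ s in (0:ℝ)..1, |Ixz s - Izx s| :=
      intervalIntegral.abs_integral_le_integral_abs zero_le_one
    have h2 : ∫ s in (0:ℝ)..1, |Ixz s - Izx s| ≤ ∫ s in (0:ℝ)..1, τ / 2 * (lam * mz s + mx s / lam) :=
      intervalIntegral.integral_mono_on zero_le_one ((cIxz.sub cIzx).abs.intervalIntegrable _ _)
        ((by fun_prop : Continuous fun s => τ / 2 * (lam * mz s + mx s / lam)).intervalIntegrable _ _)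
        fun s _ => hpt lam hlam s
    have h3 : ∫ s in (0:ℝ)..1, τ / 2 * (lam * mz s + mx s / lam) =
        τ / 2 * (lam * (∫ s in (0:ℝ)..1, mz s) + (∫ s in (0:ℝ)..1, mx s) / lam) := by
      rw [intervalIntegral.integral_const_mul, intervalIntegral.integral_add ((cmz.const_mul lam).intervalIntegrable _ _)
        ((cmx.div_const lam).intervalIntegrable _ _), intervalIntegral.integral_const_mul, intervalIntegral.integral_div]
    linarith
  -- the diagonal integrals are dominated by `Fzz`, `Fxx` (symmetric boundary terms are non-negative)
  have hnn : ∀ u : Fin 3 → ℝ, 0 ≤ u ⬝ᵥ u := fun u => by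
    rw [self_dotProduct_eq_sum_sq]; exact Finset.sum_nonneg fun i _ => sq_nonneg _
  have hmzF : ∫ s in (0:ℝ)..1, mz s ≤ Fzz := by
    have h0 : ∫ s in (0:ℝ)..1, mz s = -(c 1 ⬝ᵥ c 1) - (d 0 ⬝ᵥ d 0) + Fzz := Ezz
    linarith [hnn (c 1), hnn (d 0)]
  have hmxF : ∫ s in (0:ℝ)..1, mx s ≤ Fxx := by
    have h0 : ∫ s in (0:ℝ)..1, mx s = -(a 1 ⬝ᵥ a 1) - (b 0 ⬝ᵥ b 0) + Fxx := Exx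
    linarith [hnn (a 1), hnn (b 0)]
  have hmz0' : 0 ≤ ∫ s in (0:ℝ)..1, mz s := intervalIntegral.integral_nonneg zero_le_one fun s _ => hmz0 s
  have hmx0' : 0 ≤ ∫ s in (0:ℝ)..1, mx s := intervalIntegral.integral_nonneg zero_le_one fun s _ => hmx0 s
  have hFzz : 0 ≤ Fzz := hmz0'.trans hmzF
  have hFxx : 0 ≤ Fxx := hmx0'.trans hmxF
  -- the odd part of the `F`s is the integral of the odd part (boundary terms cancel)
  have hodd : Fxz - Fzx = (∫ s in (0:ℝ)..1, Ixz s) - ∫ s in (0:ℝ)..1, Izx s := by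
    have e1 : ∫ s in (0:ℝ)..1, Ixz s = -(a 1 ⬝ᵥ c 1) - (b 0 ⬝ᵥ d 0) + Fxz := Exz
    have e2 : ∫ s in (0:ℝ)..1, Izx s = -(c 1 ⬝ᵥ a 1) - (d 0 ⬝ᵥ b 0) + Fzx := Ezx
    rw [e1, e2, dotProduct_comm (c 1) (a 1), dotProduct_comm (d 0) (b 0)]
    ring
  -- `λ`-optimisation
  have hfin : ∀ lam : ℝ, 0 < lam → |Fxz - Fzx| ≤ τ / 2 * (lam * Fzz + Fxx / lam) := by
    intro lam hlam
    rw [hodd]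
    refine (hbound lam hlam).trans ?_
    have h1 : lam * (∫ s in (0:ℝ)..1, mz s) ≤ lam * Fzz := mul_le_mul_of_nonneg_left hmzF hlam.le
    have h2 : (∫ s in (0:ℝ)..1, mx s) / lam ≤ Fxx / lam := div_le_div_of_nonneg_right hmxF hlam.le
    nlinarith
  have := sq_le_of_forall_lambda hτ hFzz hFxx hfin
  linarith [this]

end GreenSector

/-! ## §17 EXACT sector non-expansion of the slot response `f_T(B)` -/

section Exact

/-- The forward Duhamel pairing of the slot kernel IS the quasi-static response form:
`T∫₀¹a(s)·(y·u⁺_v(s))ds = yᵀf_T(B)v` (`C = T·B`, `u⁺_v(s) = ∫₀ˢe^{−(s−r)C}a(r)v dr`; `form_qsResp_eq`). [folklore] -/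
theorem integral_pairing_duhamelFwd (ρ T : ℝ) (B : Matrix (Fin 3) (Fin 3) ℝ) (y v : Fin 3 → ℝ) :
    T * ∫ s in (0:ℝ)..1, LatticeShear.LatticeWord.trapezoid 0 1 ρ s *
        (y ⬝ᵥ ((NormedSpace.exp (-(s • (T • B)))) *ᵥ fun k => ∫ r in (0:ℝ)..s,
          LatticeShear.LatticeWord.trapezoid 0 1 ρ r * ((NormedSpace.exp (r • (T • B))) *ᵥ v) k)) =
      y ⬝ᵥ (qsResp ρ T B) *ᵥ v := by
  rw [form_qsResp_eq]
  congr 1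
  refine intervalIntegral.integral_congr fun s _ => ?_
  show _ = LatticeShear.LatticeWord.trapezoid 0 1 ρ s * _
  rw [dotProduct_duhamelFwd (T • B) (continuous_trapezoid_unit ρ) v y s]
  congr 1
  refine intervalIntegral.integral_congr fun r _ => ?_
  show _ = LatticeShear.LatticeWord.trapezoid 0 1 ρ r * _
  rw [smul_smul, mul_comm (s - r) T]

/-- The backward Duhamel pairing equals the forward one: `∫₀¹a(s)·(y·u⁻_v(s))ds = ∫₀¹a(s)·(y·u⁺_v(s))ds` — Fubini on the triangle, through
`green_swap` with the backward ADJOINT solution for `Cᵀ` and `dotProduct_exp_neg_smul_mulVec_transpose`. [folklore] -/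
theorem integral_pairing_duhamelBwd_eq (ρ : ℝ) (C : Matrix (Fin 3) (Fin 3) ℝ) (y v : Fin 3 → ℝ) :
    ∫ s in (0:ℝ)..1, LatticeShear.LatticeWord.trapezoid 0 1 ρ s *
        (y ⬝ᵥ ((NormedSpace.exp (s • C)) *ᵥ fun k => ∫ r in s..(1:ℝ),
          LatticeShear.LatticeWord.trapezoid 0 1 ρ r * ((NormedSpace.exp (-(r • C))) *ᵥ v) k)) =
      ∫ s in (0:ℝ)..1, LatticeShear.LatticeWord.trapezoid 0 1 ρ s *
        (y ⬝ᵥ ((NormedSpace.exp (-(s • C))) *ᵥ fun k => ∫ r in (0:ℝ)..s,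
          LatticeShear.LatticeWord.trapezoid 0 1 ρ r * ((NormedSpace.exp (r • C)) *ᵥ v) k)) := by
  have hφ := continuous_trapezoid_unit ρ
  rw [green_swap C hφ y v (hasDerivAt_duhamelFwd C hφ v) (duhamelFwd_zero C _ v) (hasDerivAt_duhamelBwd Cᵀ hφ y)
    (duhamelBwd_one Cᵀ _ y)]
  refine intervalIntegral.integral_congr fun s _ => ?_
  show LatticeShear.LatticeWord.trapezoid 0 1 ρ s * _ = LatticeShear.LatticeWord.trapezoid 0 1 ρ s * _
  congr 1
  rw [dotProduct_duhamelBwd C hφ v y s, dotProduct_comm _ v, dotProduct_duhamelBwd Cᵀ hφ y v s]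
  refine intervalIntegral.integral_congr fun r _ => ?_
  show LatticeShear.LatticeWord.trapezoid 0 1 ρ r * _ = LatticeShear.LatticeWord.trapezoid 0 1 ρ r * _
  rw [dotProduct_exp_neg_smul_mulVec_transpose C (r - s) y v]

/-- **EXACT SECTOR NON-EXPANSION OF THE SLOT RESPONSE.**  If the form of `B` has non-negative diagonal and lies in the Kato sector `τ ≥ 0`
(`(uᵀBw − wᵀBu)² ≤ τ²·uᵀBu·wᵀBw`), then for every ramp `ρ`, every `T ≥ 0` and all `x, z`:
`(xᵀf_T(B)z − zᵀf_T(B)x)² ≤ τ²·(xᵀf_T(B)x)·(zᵀf_T(B)z)` — the quasi-static slot response `f_T(B) = T∫₀¹a(s)∫₀ˢa(x)e^{−T(s−x)B}dxds` does NOT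
widen the sector, at every finite `T` (no `(hi/lo)²` growth factor: compare `sector_form_qsResp_of_sectorial`, p655074).  Time-domain proof: the
symmetrised double integral is the Green energy form of `C² − ∂²` (`green_energy`), an integral of sector-`τ` forms (`green_sector_abstract`).
[folklore; Kato, Perturbation Theory V §3.10 for the resolvent analogue] -/
theorem sector_form_qsResp_exact {ρ T : ℝ} (hT : 0 ≤ T) {B : Matrix (Fin 3) (Fin 3) ℝ} {τ : ℝ} (hτ : 0 ≤ τ)
    (hpsd : ∀ u : Fin 3 → ℝ, 0 ≤ u ⬝ᵥ B *ᵥ u)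
    (hsec : ∀ u w : Fin 3 → ℝ, (u ⬝ᵥ B *ᵥ w - w ⬝ᵥ B *ᵥ u) ^ 2 ≤ τ ^ 2 * ((u ⬝ᵥ B *ᵥ u) * (w ⬝ᵥ B *ᵥ w)))
    (x z : Fin 3 → ℝ) :
    (x ⬝ᵥ (qsResp ρ T B) *ᵥ z - z ⬝ᵥ (qsResp ρ T B) *ᵥ x) ^ 2 ≤
      τ ^ 2 * ((x ⬝ᵥ (qsResp ρ T B) *ᵥ x) * (z ⬝ᵥ (qsResp ρ T B) *ᵥ z)) := by
  rcases hT.eq_or_lt with h0 | hTpos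
  · -- `T = 0`: everything vanishes
    have hz : ∀ y v : Fin 3 → ℝ, y ⬝ᵥ (qsResp ρ T B) *ᵥ v = 0 := fun y v => by rw [form_qsResp_eq, ← h0, zero_mul]
    simp [hz]
  set C : Matrix (Fin 3) (Fin 3) ℝ := T • B with hC
  have hφ := continuous_trapezoid_unit ρ
  have hformC : ∀ u w : Fin 3 → ℝ, u ⬝ᵥ C *ᵥ w = T * (u ⬝ᵥ B *ᵥ w) := fun u w => by
    rw [hC, Matrix.smul_mulVec, dotProduct_smul, smul_eq_mul]
  have hpsdC : ∀ u : Fin 3 → ℝ, 0 ≤ u ⬝ᵥ C *ᵥ u := fun u => by rw [hformC]; exact mul_nonneg hTpos.le (hpsd u)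
  have hsecC : ∀ u w : Fin 3 → ℝ, (u ⬝ᵥ C *ᵥ w - w ⬝ᵥ C *ᵥ u) ^ 2 ≤ τ ^ 2 * ((u ⬝ᵥ C *ᵥ u) * (w ⬝ᵥ C *ᵥ w)) := by
    intro u w
    rw [hformC, hformC, hformC, hformC]
    have h := hsec u w
    have hT2 : 0 ≤ T ^ 2 := sq_nonneg T
    calc (T * (u ⬝ᵥ B *ᵥ w) - T * (w ⬝ᵥ B *ᵥ u)) ^ 2 = T ^ 2 * (u ⬝ᵥ B *ᵥ w - w ⬝ᵥ B *ᵥ u) ^ 2 := by ring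
      _ ≤ T ^ 2 * (τ ^ 2 * ((u ⬝ᵥ B *ᵥ u) * (w ⬝ᵥ B *ᵥ w))) := mul_le_mul_of_nonneg_left h hT2
      _ = τ ^ 2 * (T * (u ⬝ᵥ B *ᵥ u) * (T * (w ⬝ᵥ B *ᵥ w))) := by ring
  -- the four pairing identities
  have hF : ∀ y v : Fin 3 → ℝ, 2 * ∫ s in (0:ℝ)..1, LatticeShear.LatticeWord.trapezoid 0 1 ρ s *
      (y ⬝ᵥ (((NormedSpace.exp (-(s • C))) *ᵥ fun k => ∫ r in (0:ℝ)..s,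
          LatticeShear.LatticeWord.trapezoid 0 1 ρ r * ((NormedSpace.exp (r • C)) *ᵥ v) k) +
        ((NormedSpace.exp (s • C)) *ᵥ fun k => ∫ r in s..(1:ℝ),
          LatticeShear.LatticeWord.trapezoid 0 1 ρ r * ((NormedSpace.exp (-(r • C))) *ᵥ v) k))) =
      4 / T * (y ⬝ᵥ (qsResp ρ T B) *ᵥ v) := by
    intro y v
    have hcf := continuous_iff_continuousAt.2 fun s => (hasDerivAt_duhamelFwd C hφ v s).continuousAt
    have hcb := continuous_iff_continuousAt.2 fun s => (hasDerivAt_duhamelBwd C hφ v s).continuousAt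
    have h1 := integral_pairing_duhamelFwd ρ T B y v
    have h2 := integral_pairing_duhamelBwd_eq ρ C y v
    rw [← hC] at h1
    have hi1 : IntervalIntegrable (fun s => LatticeShear.LatticeWord.trapezoid 0 1 ρ s *
        (y ⬝ᵥ ((NormedSpace.exp (-(s • C))) *ᵥ fun k => ∫ r in (0:ℝ)..s,
          LatticeShear.LatticeWord.trapezoid 0 1 ρ r * ((NormedSpace.exp (r • C)) *ᵥ v) k))) volume 0 1 :=
      (hφ.mul (continuous_const.dotProduct hcf)).intervalIntegrable _ _
    have hi2 : IntervalIntegrable (fun s => LatticeShear.LatticeWord.trapezoid 0 1 ρ s *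
        (y ⬝ᵥ ((NormedSpace.exp (s • C)) *ᵥ fun k => ∫ r in s..(1:ℝ),
          LatticeShear.LatticeWord.trapezoid 0 1 ρ r * ((NormedSpace.exp (-(r • C))) *ᵥ v) k))) volume 0 1 :=
      (hφ.mul (continuous_const.dotProduct hcb)).intervalIntegrable _ _
    simp_rw [dotProduct_add, mul_add]
    rw [intervalIntegral.integral_add hi1 hi2, h2]
    have hT0 : T ≠ 0 := hTpos.ne'
    field_simp
    linarith
  have key := green_sector_abstract C hφ hτ hpsdC hsecC x z
    (hasDerivAt_duhamelFwd C hφ x) (duhamelFwd_zero C _ x) (hasDerivAt_duhamelBwd C hφ x) (duhamelBwd_one C _ x)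
    (hasDerivAt_duhamelFwd C hφ z) (duhamelFwd_zero C _ z) (hasDerivAt_duhamelBwd C hφ z) (duhamelBwd_one C _ z)
    (hF x z) (hF z x) (hF x x) (hF z z)
  have hT4 : 0 < (4 / T) ^ 2 := by positivity
  have e1 : (4 / T * (x ⬝ᵥ (qsResp ρ T B) *ᵥ z) - 4 / T * (z ⬝ᵥ (qsResp ρ T B) *ᵥ x)) ^ 2 =
      (4 / T) ^ 2 * (x ⬝ᵥ (qsResp ρ T B) *ᵥ z - z ⬝ᵥ (qsResp ρ T B) *ᵥ x) ^ 2 := by ring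
  have e2 : τ ^ 2 * (4 / T * (x ⬝ᵥ (qsResp ρ T B) *ᵥ x) * (4 / T * (z ⬝ᵥ (qsResp ρ T B) *ᵥ z))) =
      (4 / T) ^ 2 * (τ ^ 2 * ((x ⬝ᵥ (qsResp ρ T B) *ᵥ x) * (z ⬝ᵥ (qsResp ρ T B) *ᵥ z))) := by ring
  rw [e1, e2] at key
  exact le_of_mul_le_mul_left key hT4

end Exact

end Summit.AnomalousDissipation.AnomalousDissipation.Theorems.SolenoidalFractalHomogenisation.LagrangianStep.OddGain

end
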